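import Summits.PneNP.PneNP.Theorems.GapMCSPWindowCellZeroRelevance

/-!
# Gap-MCSP window cell `q = 0` (trade-off law) — VII. Boxes, products, the two exponent bounds

Part of the tree landing of HOME/decomp-pnenp-lens-1/TradeOffLaw.lean (sha256 880b490f…, lens-1 g13 of the decomp-pnenp root-decomposition cell; critic NODE-VERDICT 2026-08-30T13:09:32Z CLEARED, landing endorsed (6)(a)):
a SIZE–ACCEPTANCE TRADE-OFF for every `B₂`-circuit on `N` inputs that accepts `0^N` and every point
indicator `e_p` — `N ≤ 9·L·(L + G + 3 − N)`, `L = ⌊log₂ acc⌋`, `G` = number of gates — and its payout: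
the Oliveira–Pich–Santhanam gap problem `Gap-MCSP[2^{βn}/(cn), 2^{βn}]` (census R3) is not separated by
`B₂`-circuit families of eventually `≤ N` gates (`0 < β < 1/3`, every `c ≥ 1`), i.e. the `q = 0` cell of
the window dial of route `route-PneNP-RootDecompMagnificationPayout` (item stmt-PneNP-33309 `WindowCellZero`,
BC5 rung for the attacked item stmt-PneNP-32096). Modules, in dependency order: `…Formulas` (rooted
`B₂`-formulas and additive valuations) → `…Counting` (uniform counting, silent/flipping variables, numeric
helpers) → `…FlipLaw` (the exact acceptance law for read-once formulas) → `…Unfolding` (rooted unfolding of a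
gate list, consistency, references) → `…Potential` (variables/nodes of unfoldings, the root potential: no
duplication across root formulas) → `…Relevance` (relevant roots, link, locality) → `…Product` (boxes, the two
exponent bounds, pigeonhole, the final arithmetic) → `…Count` (`t + 2·nocc ≤ 2G + 3`) → `GapMCSPWindowCellZero`
(the law proved, the payout in tree vocabulary). Proof-internal machinery: nothing here bears on P vs NP
beyond the S-free lower bound it proves; all statements are [folklore]-tagged kernel lemmas of the lens.

THIS FILE (lens §6 + the closing arithmetic of §7): `nocc` (variable occurrences in the relevant root
formulas), the output function `outv`, the BOX of an environment and its product formula; the PRODUCT BOUND;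
T1 (silent exponent, from the silent law termwise at `0^N`), T2 (flip exponent at `e_p`, by locality only the
factor of the root reading `p` changes), PIGEONHOLE (`∃ M, nocc ≤ (t+1)·M ∧ 2^{2N+M} ≤ 2·2^{2nocc}·A²`); the
weight-`≤ 1` ball has `N + 1` points; and `arith`: the final inequality `N ≤ 9·L·(L + G + 3 − N)`.
-/

noncomputable section

set_option linter.dupNamespace false -- `Summit.PneNP.PneNP.…`: summit = sub-problem name (D-0017 single-conjunct layout)

namespace Summit.PneNP.PneNP.Theorems.GapMCSPWindowCellZero

open Literature.Computability.Complexity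

/-! ## §6 BOXES, PRODUCTS AND THE TWO EXPONENT BOUNDS

For an environment `ρ` let `BOX(ρ) = {x | ∀ w ∈ Rel, form_w^ρ(x) = ρ w}`. By LINK every point
of `BOX(aw y)` computes the same output value as `y`; by independence
`2^{N·t}·|BOX(ρ)| = 2^N·∏_w acc(form_w^ρ, ρ w)`. With `y = 0^N` and the silent law termwise we
get `2^{2N + ΣP} ≤ 2^{2·nocc}·A²`; with `y = e_p` for a flipping `p` of the relevant root `w`
(locality: flipping `p` changes no wire of smaller rank, so only the factor `w` changes, to the
complementary count) and the flip law for that factor we get `2^{2N+|Fl_w|} ≤ 2·2^{2·nocc}·A²`. -/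

section Product

open Finset
open Literature.Computability.Complexity.GateList

variable {N : ℕ}

namespace BF

section Fixed

variable {gs : List (Gate (Fin N))} {m₀ : ℕ}

/-- Total number of variable occurrences in the formulas of the relevant roots. -/
def nocc (gs : List (Gate (Fin N))) (m₀ : ℕ) : ℕ := ∑ w ∈ Rel gs m₀, (form gs m₀ w).vars.card

/-- The output value as a function of the input (`= C.eval` for the circuit `⟨gs, inr m₀, …⟩`). -/
def outv (gs : List (Gate (Fin N))) (m₀ : ℕ) (x : Fin N → Bool) : Bool := aw gs x (.inr m₀)

/-- The box of an environment. -/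
def Box (gs : List (Gate (Fin N))) (m₀ : ℕ) (ρ : Fin N ⊕ ℕ → Bool) : Finset (Fin N → Bool) :=
  univ.filter fun x => ∀ w ∈ Rel gs m₀, (form gs m₀ w).eval ρ x = ρ w

/-- Every point of the box of the wire vector of `y` computes the output value of `y` (by LINK). [folklore] -/
theorem box_card_le (hwf : WFL gs) (har : ∀ g ∈ gs, g.arity ≤ 2) (hm₀ : m₀ < gs.length)
    (y : Fin N → Bool) : (Box gs m₀ (aw gs y)).card ≤ acc (outv gs m₀) (outv gs m₀ y) := by
  refine card_le_card fun x hx => ?_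
  simp only [Box, mem_filter, mem_univ, true_and] at hx ⊢
  have := link hwf har hx _ (out_mem_Rel hm₀)
  simp only [outv]
  rw [this]

/-- **BOX PRODUCT**: `2^{N·t}·|BOX(ρ)| = 2^N·∏_w acc(form_w^ρ, ρ w)` (independence of the relevant formulas). [folklore] -/
theorem box_product (hwf : WFL gs) (har : ∀ g ∈ gs, g.arity ≤ 2) (hm₀ : m₀ < gs.length)
    (ρ : Fin N ⊕ ℕ → Bool) :
    2 ^ (N * (Rel gs m₀).card) * (Box gs m₀ ρ).card =
      2 ^ N * ∏ w ∈ Rel gs m₀, acc ((form gs m₀ w).eval ρ) (ρ w) :=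
  box (Rel gs m₀) (fun w => (form gs m₀ w).eval ρ) (fun w => (form gs m₀ w).vars) ρ
    (fun _ _ => dependsOn_eval ρ _) (fun _ hw _ hw' hne => disjoint_form_vars hwf har hm₀ hw hw' hne)

/-- **PRODUCT BOUND**: termwise exponent bounds for the factors of a box whose environment is
the wire vector of an accepted input add up against `A²`. -/
theorem product_bound (hwf : WFL gs) (har : ∀ g ∈ gs, g.arity ≤ 2) (hm₀ : m₀ < gs.length)
    (y : Fin N → Bool) (hy : outv gs m₀ y = true) (c d : Fin N ⊕ ℕ → ℕ)
    (hcd : ∀ w ∈ Rel gs m₀, 2 ^ (2 * N + d w) ≤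
      c w * 2 ^ (2 * (form gs m₀ w).vars.card) * acc ((form gs m₀ w).eval (aw gs y)) (aw gs y w) ^ 2) :
    2 ^ (2 * N + ∑ w ∈ Rel gs m₀, d w) ≤
      (∏ w ∈ Rel gs m₀, c w) * 2 ^ (2 * nocc gs m₀) * acc (outv gs m₀) true ^ 2 := by
  set T := Rel gs m₀ with hT
  set t := T.card with ht
  set P := ∏ w ∈ T, acc ((form gs m₀ w).eval (aw gs y)) (aw gs y w) with hP
  set A := acc (outv gs m₀) true with hA
  have hbox := box_product hwf har hm₀ (aw gs y)
  have hBA : (Box gs m₀ (aw gs y)).card ≤ A := by rw [hA, ← hy]; exact box_card_le hwf har hm₀ y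
  -- (E1) `2^N P ≤ 2^{Nt} A`
  have E1 : 2 ^ N * P ≤ 2 ^ (N * t) * A := by
    rw [hP, ← hbox]; exact Nat.mul_le_mul_left _ hBA
  -- (E2) product of the termwise bounds
  have E2 : ∏ w ∈ T, 2 ^ (2 * N + d w) ≤
      ∏ w ∈ T, (c w * 2 ^ (2 * (form gs m₀ w).vars.card) *
        acc ((form gs m₀ w).eval (aw gs y)) (aw gs y w) ^ 2) :=
    prod_le_prod (fun _ _ => Nat.zero_le _) hcd
  have lhs : ∏ w ∈ T, 2 ^ (2 * N + d w) = 2 ^ (2 * N * t + ∑ w ∈ T, d w) := by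
    rw [prod_pow_eq_pow_sum, sum_add_distrib, sum_const, smul_eq_mul, ← ht]; ring_nf
  have rhs : ∏ w ∈ T, (c w * 2 ^ (2 * (form gs m₀ w).vars.card) *
        acc ((form gs m₀ w).eval (aw gs y)) (aw gs y w) ^ 2) =
      (∏ w ∈ T, c w) * 2 ^ (2 * nocc gs m₀) * P ^ 2 := by
    rw [prod_mul_distrib, prod_mul_distrib, prod_pow, prod_pow_eq_pow_sum, nocc, mul_sum]
  rw [lhs, rhs] at E2
  have hpos : 0 < 2 ^ (2 * N * t) := by positivity
  refine Nat.le_of_mul_le_mul_left ?_ hpos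
  have E1sq : (2 ^ N * P) ^ 2 ≤ (2 ^ (N * t) * A) ^ 2 := Nat.pow_le_pow_left E1 2
  calc 2 ^ (2 * N * t) * 2 ^ (2 * N + ∑ w ∈ T, d w)
      = 2 ^ (2 * N) * 2 ^ (2 * N * t + ∑ w ∈ T, d w) := by ring
    _ ≤ 2 ^ (2 * N) * ((∏ w ∈ T, c w) * 2 ^ (2 * nocc gs m₀) * P ^ 2) := Nat.mul_le_mul_left _ E2
    _ = (∏ w ∈ T, c w) * 2 ^ (2 * nocc gs m₀) * (2 ^ N * P) ^ 2 := by ring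
    _ ≤ (∏ w ∈ T, c w) * 2 ^ (2 * nocc gs m₀) * (2 ^ (N * t) * A) ^ 2 := Nat.mul_le_mul_left _ E1sq
    _ = 2 ^ (2 * N * t) * ((∏ w ∈ T, c w) * 2 ^ (2 * nocc gs m₀) * A ^ 2) := by ring

/-- The base value of the formula of a relevant wire in the `0^N`-environment is the wire's
value at `0^N`. -/
theorem base_eq (hwf : WFL gs) (har : ∀ g ∈ gs, g.arity ≤ 2) (w : Fin N ⊕ ℕ) :
    (form gs m₀ w).eval (aw gs x0) x0 = aw gs x0 w := form_eval_aw hwf har m₀ w x0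

/-- **T1 (silent exponent)**. -/
theorem T1 (hwf : WFL gs) (har : ∀ g ∈ gs, g.arity ≤ 2) (hm₀ : m₀ < gs.length)
    (h0 : outv gs m₀ x0 = true) :
    2 ^ (2 * N + ∑ w ∈ Rel gs m₀, (sil ((form gs m₀ w).eval (aw gs x0)) (form gs m₀ w).vars).card) ≤
      2 ^ (2 * nocc gs m₀) * acc (outv gs m₀) true ^ 2 := by
  have h := product_bound hwf har hm₀ x0 h0 (fun _ => 1)
    (fun w => (sil ((form gs m₀ w).eval (aw gs x0)) (form gs m₀ w).vars).card) (fun w hw => ?_)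
  · simpa using h
  · have := (flipLaw (aw gs x0) (form gs m₀ w) (readOnce_form hwf har hm₀ hw)).1
    rwa [base_eq hwf har] at this

/-- Flipping a variable of the formula of the relevant wire `w` changes no relevant wire of
smaller rank, hence no reference of `form w`. -/
theorem env_agree_below (hwf : WFL gs) (har : ∀ g ∈ gs, g.arity ≤ 2) (hm₀ : m₀ < gs.length)
    {w : Fin N ⊕ ℕ} (hw : w ∈ Rel gs m₀) {p : Fin N} (hp : p ∈ (form gs m₀ w).vars) :
    ∀ w' ∈ (form gs m₀ w).refs, aw gs (e p) w' = aw gs x0 w' := by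
  intro w' hw'
  obtain ⟨h1, h2⟩ := refs_form hwf hw w' hw'
  refine aw_congr hwf har (rk w') w' h1 le_rfl (fun w'' hw'' hrk q hq => ?_)
  have hne : w'' ≠ w := fun h => by subst h; omega
  have hdisj := disjoint_form_vars hwf har hm₀ hw'' hw hne
  have hqp : q ≠ p := fun h => Finset.disjoint_left.1 hdisj hq (h ▸ hp)
  simp [e_apply_of_ne hqp]

/-- **T2 (flip exponent)** for one relevant wire with a flipping variable. -/
theorem T2 (hwf : WFL gs) (har : ∀ g ∈ gs, g.arity ≤ 2) (hm₀ : m₀ < gs.length)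
    (h1 : ∀ p, outv gs m₀ (e p) = true) {w : Fin N ⊕ ℕ} (hw : w ∈ Rel gs m₀)
    (hne : (flp ((form gs m₀ w).eval (aw gs x0)) (form gs m₀ w).vars).Nonempty) :
    2 ^ (2 * N + (flp ((form gs m₀ w).eval (aw gs x0)) (form gs m₀ w).vars).card) ≤
      2 * 2 ^ (2 * nocc gs m₀) * acc (outv gs m₀) true ^ 2 := by
  classical
  obtain ⟨p, hp⟩ := hne
  have hpv : p ∈ (form gs m₀ w).vars := flp_subset _ _ hp
  have hpf : (form gs m₀ w).eval (aw gs x0) (e p) ≠ (form gs m₀ w).eval (aw gs x0) x0 := by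
    simp only [flp, mem_filter] at hp; exact hp.2
  set F := form gs m₀ w with hF
  set f := F.eval (aw gs x0) with hf
  -- the two environments agree on the references of `F`
  have henv : F.eval (aw gs (e p)) = f := by
    funext x
    exact eval_congr_ref F (env_agree_below hwf har hm₀ hw hpv) x
  have hval : aw gs (e p) w = ! f x0 := by
    rw [← form_eval_aw hwf har m₀ w (e p), ← hF, henv]
    exact Bool.eq_not_iff.2 hpf
  have h := product_bound hwf har hm₀ (e p) (h1 p) (fun w' => if w' = w then 2 else 1)
    (fun w' => if w' = w then (flp f F.vars).card else 0) (fun w' hw' => ?_)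
  · rw [prod_ite_eq' (Rel gs m₀) w (fun _ => 2) , sum_ite_eq'] at h
    simpa [hw] using h
  · by_cases hww : w' = w
    · subst hww
      simp only [if_true]
      rw [← hF, henv, hval]
      have := (flipLaw (aw gs x0) F (readOnce_form hwf har hm₀ hw)).2 ⟨p, hp⟩
      exact this
    · simp only [hww, if_false, add_zero, one_mul]
      have hc := cylinder (dependsOn_eval (aw gs (e p)) (form gs m₀ w'))
        (form_eval_aw hwf har m₀ w' (e p))
      calc 2 ^ (2 * N) = 2 ^ N * 2 ^ N := by ring
        _ ≤ (2 ^ (form gs m₀ w').vars.card * acc ((form gs m₀ w').eval (aw gs (e p))) (aw gs (e p) w')) *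
            (2 ^ (form gs m₀ w').vars.card * acc ((form gs m₀ w').eval (aw gs (e p))) (aw gs (e p) w')) :=
          Nat.mul_le_mul hc hc
        _ = 2 ^ (2 * (form gs m₀ w').vars.card) *
            acc ((form gs m₀ w').eval (aw gs (e p))) (aw gs (e p) w') ^ 2 := by ring

/-- **PIGEONHOLE**: some exponent `M` with `nocc ≤ (t+1)·M` satisfies `2^{2N+M} ≤ 2·2^{2nocc}·A²`. -/
theorem pigeon (hwf : WFL gs) (har : ∀ g ∈ gs, g.arity ≤ 2) (hm₀ : m₀ < gs.length)
    (h0 : outv gs m₀ x0 = true) (h1 : ∀ p, outv gs m₀ (e p) = true) :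
    ∃ M, nocc gs m₀ ≤ ((Rel gs m₀).card + 1) * M ∧
      2 ^ (2 * N + M) ≤ 2 * 2 ^ (2 * nocc gs m₀) * acc (outv gs m₀) true ^ 2 := by
  classical
  set T := Rel gs m₀ with hT
  let Pc : Fin N ⊕ ℕ → ℕ := fun w => (sil ((form gs m₀ w).eval (aw gs x0)) (form gs m₀ w).vars).card
  let Fc : Fin N ⊕ ℕ → ℕ := fun w => (flp ((form gs m₀ w).eval (aw gs x0)) (form gs m₀ w).vars).card
  have hsplit : nocc gs m₀ = ∑ w ∈ T, Pc w + ∑ w ∈ T, Fc w := by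
    rw [nocc, ← sum_add_distrib]
    refine sum_congr rfl fun w _ => ?_
    exact (sil_card_add_flp_card _ _).symm
  have hFle : ∀ w ∈ T, Fc w ≤ T.sup Fc := fun w hw => le_sup hw
  have hTne : T.Nonempty := ⟨_, out_mem_Rel hm₀⟩
  obtain ⟨w₁, hw₁, hsup⟩ := exists_mem_eq_sup T hTne Fc
  refine ⟨max (∑ w ∈ T, Pc w) (Fc w₁), ?_, ?_⟩
  · have h2 : ∑ w ∈ T, Fc w ≤ T.card * Fc w₁ := by
      rw [← smul_eq_mul, ← hsup]
      exact sum_le_card_nsmul _ _ _ hFle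
    rw [hsplit]
    nlinarith [le_max_left (∑ w ∈ T, Pc w) (Fc w₁), le_max_right (∑ w ∈ T, Pc w) (Fc w₁)]
  · rcases max_choice (∑ w ∈ T, Pc w) (Fc w₁) with hmax | hmax <;> rw [hmax]
    · calc 2 ^ (2 * N + ∑ w ∈ T, Pc w) ≤ 2 ^ (2 * nocc gs m₀) * acc (outv gs m₀) true ^ 2 :=
            T1 hwf har hm₀ h0
        _ ≤ 2 * 2 ^ (2 * nocc gs m₀) * acc (outv gs m₀) true ^ 2 := by
            rw [mul_assoc]; exact Nat.le_mul_of_pos_left _ (by norm_num)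
    · by_cases hne : (flp ((form gs m₀ w₁).eval (aw gs x0)) (form gs m₀ w₁).vars).Nonempty
      · exact T2 hwf har hm₀ h1 hw₁ hne
      · have h0' : Fc w₁ = 0 := by
          simp only [Fc, card_eq_zero]; exact not_nonempty_iff_eq_empty.1 hne
        rw [h0']
        calc 2 ^ (2 * N + 0) ≤ 2 ^ (2 * N + ∑ w ∈ T, Pc w) :=
              Nat.pow_le_pow_right (by norm_num) (by omega)
          _ ≤ 2 ^ (2 * nocc gs m₀) * acc (outv gs m₀) true ^ 2 := T1 hwf har hm₀ h0
          _ ≤ 2 * 2 ^ (2 * nocc gs m₀) * acc (outv gs m₀) true ^ 2 := by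
              rw [mul_assoc]; exact Nat.le_mul_of_pos_left _ (by norm_num)

end Fixed

end BF

end Product

section Ball

open Finset

variable {N : ℕ}

namespace BF

/-- The weight-`≤ 1` ball has `N + 1` points. -/
theorem succ_le_acc {f : (Fin N → Bool) → Bool} (h0 : f x0 = true) (h1 : ∀ p, f (e p) = true) :
    N + 1 ≤ acc f true := by
  classical
  have hinj : Function.Injective (e : Fin N → Fin N → Bool) := by
    intro p q hpq
    have := congrFun hpq p
    simp only [e_apply_self] at this
    by_contra hne
    rw [e_apply_of_ne hne] at this
    exact Bool.noConfusion this
  have hx0 : (x0 : Fin N → Bool) ∉ (univ : Finset (Fin N)).image e := by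
    intro h
    obtain ⟨p, -, hp⟩ := mem_image.1 h
    have := congrFun hp p
    simp at this
  have hcard : (insert x0 ((univ : Finset (Fin N)).image e)).card = N + 1 := by
    rw [card_insert_of_notMem hx0, card_image_of_injective _ hinj, card_univ, Fintype.card_fin]
  rw [← hcard]
  refine card_le_card fun x hx => ?_
  simp only [mem_insert, mem_image, mem_univ, true_and] at hx
  simp only [mem_filter, mem_univ, true_and]
  rcases hx with rfl | ⟨p, rfl⟩
  · exact h0
  · exact h1 p

/-- **The final arithmetic.** -/
theorem arith (N G A t n M : ℕ) (hnN : n ≤ N) (hA1 : 2 ^ (2 * N + M) ≤ 2 * 2 ^ (2 * n) * A ^ 2)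
    (hM : n ≤ (t + 1) * M) (ht : t + 2 * n ≤ 2 * G + 3) (hAN : N + 1 ≤ A) :
    N ≤ 9 * Nat.log 2 A * (Nat.log 2 A + G + 3 - N) := by
  rcases Nat.eq_zero_or_pos N with hN | hN
  · subst hN; exact Nat.zero_le _
  set L := Nat.log 2 A with hL
  have hA2 : 2 ≤ A := by omega
  have hL1 : 1 ≤ L := Nat.log_pos (by norm_num) hA2
  have hAlt : A < 2 ^ (L + 1) := Nat.lt_pow_succ_log_self (by norm_num) A
  have key : 2 * N + M < 2 * n + 2 * L + 3 := by
    have h1 : A ^ 2 < (2 ^ (L + 1)) ^ 2 := Nat.pow_lt_pow_left hAlt (by norm_num)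
    have h2 : 2 ^ (2 * N + M) < 2 ^ (2 * n + 2 * L + 3) :=
      calc 2 ^ (2 * N + M) ≤ 2 * 2 ^ (2 * n) * A ^ 2 := hA1
        _ < 2 * 2 ^ (2 * n) * (2 ^ (L + 1)) ^ 2 := Nat.mul_lt_mul_of_pos_left h1 (by positivity)
        _ = 2 ^ (2 * n + 2 * L + 3) := by ring
    exact (Nat.pow_lt_pow_iff_right (by norm_num)).1 h2
  by_cases hM0 : M = 0
  · subst hM0
    have hn0 : n = 0 := by simpa using hM
    subst hn0
    have hE : 2 ≤ L + G + 3 - N := by omega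
    calc N ≤ 9 * L * 2 := by omega
      _ ≤ 9 * L * (L + G + 3 - N) := Nat.mul_le_mul_left _ hE
  · have h2 : N ≤ n + L := by omega
    have hM' : M ≤ 2 * L + 2 := by omega
    set E := L + G + 3 - N with hE
    have hE1 : t + 1 ≤ 2 * E := by omega
    have hE2 : 1 ≤ E := by omega
    have hn : n ≤ 2 * E * (2 * L + 2) := hM.trans (Nat.mul_le_mul hE1 hM')
    set k := L * E with hk
    have hn' : n ≤ 4 * k + 4 * E := by
      have : 2 * E * (2 * L + 2) = 4 * (L * E) + 4 * E := by ring
      rw [this, ← hk] at hn; exact hn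
    have hk1 : E ≤ k := by rw [hk]; exact Nat.le_mul_of_pos_left E hL1
    have hk2 : L ≤ k := by rw [hk]; exact Nat.le_mul_of_pos_right L hE2
    calc N ≤ 9 * k := by omega
      _ = 9 * L * E := by rw [hk]; ring

end BF

end Ball

end Summit.PneNP.PneNP.Theorems.GapMCSPWindowCellZero
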